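import Summits.QuantumFields.BalabanUV.Beta.D1BFx.PackedTowerSlots

/-!
# `BalabanUV.Beta.D1BFx.PackedTowerSlotsGram` — road «BF-x» for binder row D1, slot (K), chain step (I) «(A1)-PACKED», brick (B5) «GRAM-COV-PACKED»,
# FILE 2b «TOWER-PACKED-GRAM»: **ON EVERY COARSE TORUS THE TWISTED COVARIANT-GRAM TOWER SLOT OF `identity_array_currency_cov_What0_stripped` AT
# RESPONSE-PACKED JETS IS THE `Cgh` TORUS FUNCTIONAL OF PERIODISED ARRAYS OF THE PACKED GHOST WORDS** — first order `Σ_κ wsum (w κ) (Lgh κ)`, second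
# order the packed `L̂²`-pair word in PRODUCT form (FINDING F-g16-1 «WRAP»: the wrap-around is TA2's `arr` INSIDE the product of the two packed `Ljet`s,
# on every torus, no side condition)

HONEST DEPENDENCY (cell records, verbatim): «continuum YM on T⁴ ⇐ BetaPertH ∧ nine spine estimates (0/9 proved); BetaPertH ⇐ (D1) ∧ (D4) ∧
CAP+tail; G-an2-4 gates asym, D1 and NE2/3/4.»  HONEST FRAMING (cell contract, verbatim): «discharging `BetaPertH` makes Bałaban's UV stability
UNCONDITIONAL — a real constructive-QFT result; it is NOT the continuum limit and NOT the Clay problem.»  THIS MODULE DISCHARGES NOTHING of (K),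
of D1 or of the wall: [folklore] finite (bi)linear algebra and torus ∕ `ℤ⁴` array bookkeeping BY NAME over the road owner's «SLOT-PACK»
(`PackedSlotMultilinear`: `tgram₁_packed`, `tgramMix_packed`, `hessT_tgram_packed`, `hessT_packed`), `KCombineCovColourTorus` §1–§2 (`K`-drop under
WARD-L, `hessT_tgram_eq_gram`), `KGramCovJets` (`hessT_gramCov_B_eq_Gjet`, `hessT_Gjet_eq_Cgh_Lsq` — arbitrary torus bond pairs), this lineage's
`KCombineCovTowers.Lsq₁_fst_eq_arr`, leaf-05's TB4-W 3b-gh (`TorusGhostWordArrays` ∕ `TorusGhostPairStencils` ∕ `TorusGhostPairArrays`), FILE 1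
`PeriodicArrayPackingPlain` and FILE 2a `PackedTowerSlots`.  DISPLAYED: the ONE-SIDED WARD-L letters `hE•` of the literal's form jets against the packed
gauge jets, and the PINNING of the packed gauge ∕ co-frame jets to THE CONVENTION ∕ TB4-W at the torus' fine bonds («COFRAME-PACK» as hypotheses).
No definition, no `def … : Prop`, nothing cited, 0 sorry.  0 root-level binders of row D1 discharged; (K) NOT closed; NOT D1, NOT `BetaPertH`, NOT
continuum, NOT Clay.

ABSOLUTE RULE (cell charter, verbatim): «No internally-minted statement may enter as a cited fact. Every hypothesis is either kernel-proved in this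
package or a verbatim quotation of a PUBLISHED theorem with page reference. The manuscript(s) under audit are NOT citable for their own disputed
steps — they are the thing under adjudication; programme-internal (2001/route/tribunal) claims are never citable.»

SETTING: as FILE 2a (torus `n = m+1`, period `p`, `s = (m+1)·p`, root `r ∈ box 4 (m+1)`, `0 < a`; bond index `k : I 3 (m+1) p`, torus bond `e₁ (m+1) p k`,
window representative `ŵ_k`; weight families `wₛ wₜ` decaying at a rate `0 < δ ≤ ½`, torus responses `rₛ rₜ` with letters `hrₛ hrₜ`).
* §3 the packed `L̂²` words: `ghCur_imageShift`, `gh₂_imageShift`, `Lgh_imageShift`, **`sum_smul_Lsq₁_fst`** (`Σ_k rₛ k • ((L̂²)_{e₁ k})ᶠ = (arr s ℒ₁[wₛ])^`),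
  `sum_smul_Ljet`, `sum_smul_Ljet₂`, **`sum_sum_smul_Lsq₁₁`** (the PACKED pair word multiplied out — `Ljet₁₁` is bond-diagonal), `perT_arr_add₄`,
  **`sum_sum_smul_Lsq₁₁_eq_perT`** ∕ `sum_sum_smul_Lsq₁₁_fst_eq_arr` (`Σ_k Σ_l (rₛ k·rₜ l) • (L̂²)_{e₁ k,e₁ l} = perT s (arr s ℒ₂ˢ)`, `ℒ₂ˢ` in PRODUCT form).
* §4 **`hessT_tgramCov_packed_eq_arr`** — «GRAM-COV-PACKED» per torus.
Unit `b2b-balaban-beta-d1-formalise-leaf-03` (gen 22); road owner `b2b-balaban-beta-d1-p2`.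
-/

noncomputable section

namespace Summit.QuantumFields.BalabanUV.Beta.D1BFx.PackedTowerSlotsGram

open Matrix
open scoped BigOperators
open Literature.Probability.LatticeModels (TorusSite)
open Literature.MathematicalPhysics.QuantumFieldTheory.Balaban1983to89
open Literature.MathematicalPhysics.QuantumFieldTheory.Balaban1983to89.Beta
open B12Sec2to5 (l1 l1_nonneg)
open ExpKernelCalculus (MKer BiLoc Decays comp shiftK Zl Zl_pos Zl_nonneg)
open AffineAveraging (box toSite unitVec)
open KKTFluctuationKernel (delta1)
open OneStepResolventKernel (wsum biLoc_wsum)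
open KernelWard (biLoc_recentre biLoc_add)
open BalabanStepJetsSucc (biLoc_comp_right)
open Summit.QuantumFields.BalabanUV.Beta.AxialProjectorBlockMean (bmGaugeAt)
open Summit.QuantumFields.BalabanUV.Beta.D1BFx.FibredPeriodisation (periodiseF)
open Summit.QuantumFields.BalabanUV.Beta.D1BFx.SortedReblocking (torusBlockEquiv imageShift_mul_eq_add)
open Summit.QuantumFields.BalabanUV.Beta.D1BFx.SortedEmbedding (e₁ e₁_apply)
open Summit.QuantumFields.BalabanUV.Beta.D1BFx.PeriodicArrays (arr toF decays_arr arr_imageShift)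
open Summit.QuantumFields.BalabanUV.Beta.D1BFx.MixedVarPackedHess (hessT)
open Summit.QuantumFields.BalabanUV.Beta.D1BFx.GramWeightJets (gram₀ gram₁)
open Summit.QuantumFields.BalabanUV.Beta.D1BFx.GramWeightJetsMixed (gramMix)
open Summit.QuantumFields.BalabanUV.Beta.D1BFx.GramWeightColourLift (tgram₁ tgramMix)
open Summit.QuantumFields.BalabanUV.Beta.D1BFx.TorusCombKKT (I J CombRows tauT Khat)
open Summit.QuantumFields.BalabanUV.Beta.D1BFx.TorusGaugeBasis (What0 Khat_mul_What0)
open Summit.QuantumFields.BalabanUV.Beta.D1BFx.TorusGaugeBasisMatrix (NhatF Nhat bmGaugeAt_shift shift_delta1)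
open Summit.QuantumFields.BalabanUV.Beta.D1BFx.PeriodisedProjector (Lhat)
open Summit.QuantumFields.BalabanUV.Beta.D1BFx.TorusCoframeJets (Djet Ljet Ljet₂ Ljet₁₁ Ljet₁₁_self Ljet₁₁_of_ne Tjet₀ Tjet₁ Tjet₁₁ Ajet₀ Ajet₁ Ajet₁₁)
open Summit.QuantumFields.BalabanUV.Beta.D1BFx.TorusWeightJetsCombFree (Lsq₁ Lsq₁₁)
open Summit.QuantumFields.BalabanUV.Beta.D1BFx.GhostStencil (ghCur biLoc_ghCur ghCur_translate l1_unitVec l1_zero)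
open Summit.QuantumFields.BalabanUV.Beta.D1BFx.GaugeJetLocal (idK1)
open Summit.QuantumFields.BalabanUV.Beta.D1BFx.KGhostLeg (Cgh)
open Summit.QuantumFields.BalabanUV.Beta.D1BFx.TorusGhostWordArrays (perT lapU Lgh Ljet_eq_perT perT_add perT_arr_mul_perT perT_mul_perT_arr
  summable_row_arr arr_add decays_lapU lapU_imageShift Lhat_eq_perT biLoc_Lgh Lgh_translate)
open Summit.QuantumFields.BalabanUV.Beta.D1BFx.TorusGhostPairStencils (gh₂ biLoc_gh₂ gh₂_translate perT_arr_mul_perT_arr)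
open Summit.QuantumFields.BalabanUV.Beta.D1BFx.TorusGhostPairArrays (Ljet₂_eq_perT)
open Summit.QuantumFields.BalabanUV.Beta.D1BFx.KCombineCovLegs (det_Tjet₀_mul_What0_ne_zero det_Ajet₀_Nhat_ne_zero)
open Summit.QuantumFields.BalabanUV.Beta.D1BFx.KGramCovJets (hessT_gramCov_B_eq_Gjet hessT_Gjet_eq_Cgh_Lsq)
open Summit.QuantumFields.BalabanUV.Beta.D1BFx.KCombineCovColourTorus (gram₀_add_of_wardL tgram₁_add_eq_of_wardL tgramMix_add_eq_of_wardL
  hessT_tgram_eq_gram)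
open Summit.QuantumFields.BalabanUV.Beta.D1BFx.KCombineCovTowers (submatrix_fst_perT Lsq₁_fst_eq_arr)
open Summit.QuantumFields.BalabanUV.Beta.D1BFx.CombFPWordArrays (nFcol nFcol_apply biLoc_nFcol NhatF_sub_mul_Djet_sub_eq_arr)
open Summit.QuantumFields.BalabanUV.Beta.D1BFx.KCombineCovCombLeg (hessT_combFP_What0_eq_idK1)
open Summit.QuantumFields.BalabanUV.Beta.D1BFx.PackedSlotMultilinear (hessT_packed hessT_tgram_packed tgram₁_packed tgramMix_packed)
open Summit.QuantumFields.BalabanUV.Beta.D1BFx.PeriodicArrayPackingPlain (periodiseF_toF_arr_dirsum_wsum periodiseF_toF_arr_dirsum_wsum_per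
  biLoc_dirsum_wsum biLoc_dirsum_wsum_per)

open Summit.QuantumFields.BalabanUV.Beta.D1BFx.PackedTowerSlots (e₁_eq_siteOf submatrix_sum_sum_smul sum_smul_perT_arr sum_smul_perT_arr_per)

/-! ## §3 The packed `L̂²` words of the «GRAM-COV» slot -/

section LsqWords

variable {m : ℕ} (p : ℕ) [NeZero p] {w w' : Fin 4 → (Fin 4 → ℤ) → ℝ} {C C' δ : ℝ} {P P' : Fin 4 → ℤ} {r r' : I 3 (m + 1) p → ℝ}

/-- [folklore] The ghost stencils of TB4-W are PERIOD-covariant (they are covariant under every translation). -/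
theorem ghCur_imageShift (s : ℕ) (κ : Fin 4) (u t : Fin 4 → ℤ) : ghCur κ (imageShift s u t) = shiftK (-((s : ℤ) • t)) (ghCur κ u) := by
  rw [PeriodicArrays.imageShift_eq_add_smul, ghCur_translate]

/-- [folklore] … `gh₂`. -/
theorem gh₂_imageShift (s : ℕ) (κ : Fin 4) (u t : Fin 4 → ℤ) : gh₂ κ (imageShift s u t) = shiftK (-((s : ℤ) • t)) (gh₂ κ u) := by
  rw [PeriodicArrays.imageShift_eq_add_smul, gh₂_translate]

/-- [folklore] … `Lgh`. -/
theorem Lgh_imageShift (s : ℕ) (κ : Fin 4) (u t : Fin 4 → ℤ) : Lgh κ (imageShift s u t) = shiftK (-((s : ℤ) • t)) (Lgh κ u) := by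
  rw [PeriodicArrays.imageShift_eq_add_smul, Lgh_translate]

/-- [folklore] **THE PACKED FIRST `L̂²`-WORD**: `Σ_k r k • ((L̂²)_{e₁ k})ᶠ = (arr s (Σ_κ wsum (w κ) (Lgh κ)))^` for responses `r k = Σ'_m w κ′_k (ŵ_k + s·m)` and a
weight family decaying at a rate `0 < δ ≤ ½` (`KCombineCovTowers.Lsq₁_fst_eq_arr` per bond + FILE 1). -/
theorem sum_smul_Lsq₁_fst (hw : ∀ κ u, |w κ u| ≤ C * Real.exp (-δ * l1 (u - P))) (hδ : 0 < δ) (hδ1 : δ ≤ 1 / 2)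
    (hr : ∀ k, r k = ∑' t : Fin 4 → ℤ, w k.2.2 (imageShift ((m + 1) * p) (windowMap 4 ((m + 1) * p) (torusBlockEquiv (m + 1) p (k.1, k.2.1))) t)) :
    ∑ k : I 3 (m + 1) p, r k • (Lsq₁ ((m + 1) * p) (e₁ (m + 1) p k)).submatrix Prod.fst Prod.fst
      = Matrix.of (periodiseF ((m + 1) * p) (toF (arr ((m + 1) * p) (fun x y a b => ∑ κ : Fin 4, wsum (w κ) (Lgh κ) x y a b)))) := by
  have hS : ∀ κ u, BiLoc (Lgh κ u) u u TorusGhostWordArrays.cL δ := fun κ u => StepJetData.biLoc_weaken (biLoc_Lgh κ u) le_rfl hδ1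
  rw [show (∑ k : I 3 (m + 1) p, r k • (Lsq₁ ((m + 1) * p) (e₁ (m + 1) p k)).submatrix Prod.fst Prod.fst)
      = ∑ k : I 3 (m + 1) p, (∑' t : Fin 4 → ℤ, w k.2.2 (imageShift ((m + 1) * p) (windowMap 4 ((m + 1) * p) (torusBlockEquiv (m + 1) p (k.1, k.2.1))) t))
          • Matrix.of (periodiseF ((m + 1) * p) (toF (arr ((m + 1) * p) (Lgh k.2.2 (windowMap 4 ((m + 1) * p) (torusBlockEquiv (m + 1) p (k.1, k.2.1)))))))
      from Finset.sum_congr rfl fun k _ => by rw [e₁_eq_siteOf, Lsq₁_fst_eq_arr, hr k],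
    ← periodiseF_toF_arr_dirsum_wsum (d := 3) hw hS (fun κ u t => Lgh_imageShift _ κ u t) hδ
      (PeriodicArrayWrapLimit.const_nonneg_of_weight (hw 0))]

/-- [folklore] **THE PACKED `Ljet`**: `Σ_k r k • Ljet s (e₁ k) = perT s (arr s (Σ_κ wsum (w κ) (ghCur κ)))` (`Ljet_eq_perT` per bond + FILE 1; any rate `δ > 0`). -/
theorem sum_smul_Ljet (hw : ∀ κ u, |w κ u| ≤ C * Real.exp (-δ * l1 (u - P))) (hδ : 0 < δ)
    (hr : ∀ k, r k = ∑' t : Fin 4 → ℤ, w k.2.2 (imageShift ((m + 1) * p) (windowMap 4 ((m + 1) * p) (torusBlockEquiv (m + 1) p (k.1, k.2.1))) t)) :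
    ∑ k : I 3 (m + 1) p, r k • Ljet ((m + 1) * p) (e₁ (m + 1) p k)
      = perT ((m + 1) * p) (arr ((m + 1) * p) (fun x y a b => ∑ κ : Fin 4, wsum (w κ) (ghCur κ) x y a b)) := by
  rw [show (∑ k : I 3 (m + 1) p, r k • Ljet ((m + 1) * p) (e₁ (m + 1) p k))
      = ∑ k : I 3 (m + 1) p, r k • perT ((m + 1) * p) (arr ((m + 1) * p) (ghCur k.2.2 (windowMap 4 ((m + 1) * p) (torusBlockEquiv (m + 1) p (k.1, k.2.1)))))
      from Finset.sum_congr rfl fun k _ => by rw [e₁_eq_siteOf, Ljet_eq_perT]]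
  exact sum_smul_perT_arr p hw (fun κ u => biLoc_ghCur κ u δ) (fun κ u t => ghCur_imageShift _ κ u t) hδ
    (PeriodicArrayWrapLimit.const_nonneg_of_weight (hw 0)) hr

/-- [folklore] **THE PACKED DIAGONAL `Ljet₂`**: `Σ_k (r k·r′ k) • Ljet₂ s (e₁ k) = perT s (arr s 𝒟ˢ)`,
`𝒟ˢ := Σ_κ wsum (w κ) (u ↦ (Σ'_m w′ κ (u + s·m)) · gh₂ κ u)` (`Ljet₂_eq_perT` per bond + FILE 1's diagonal reading). -/
theorem sum_smul_Ljet₂ (hw : ∀ κ u, |w κ u| ≤ C * Real.exp (-δ * l1 (u - P))) (hw' : ∀ κ u, |w' κ u| ≤ C' * Real.exp (-δ * l1 (u - P')))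
    (hδ : 0 < δ)
    (hr : ∀ k, r k = ∑' t : Fin 4 → ℤ, w k.2.2 (imageShift ((m + 1) * p) (windowMap 4 ((m + 1) * p) (torusBlockEquiv (m + 1) p (k.1, k.2.1))) t))
    (hr' : ∀ k, r' k = ∑' t : Fin 4 → ℤ, w' k.2.2 (imageShift ((m + 1) * p) (windowMap 4 ((m + 1) * p) (torusBlockEquiv (m + 1) p (k.1, k.2.1))) t)) :
    ∑ k : I 3 (m + 1) p, (r k * r' k) • Ljet₂ ((m + 1) * p) (e₁ (m + 1) p k)
      = perT ((m + 1) * p) (arr ((m + 1) * p) (fun x y a b => ∑ κ : Fin 4,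
          wsum (w κ) (fun u => fun x y a b => (∑' t : Fin 4 → ℤ, w' κ (imageShift ((m + 1) * p) u t)) * gh₂ κ u x y a b) x y a b)) := by
  rw [show (∑ k : I 3 (m + 1) p, (r k * r' k) • Ljet₂ ((m + 1) * p) (e₁ (m + 1) p k))
      = ∑ k : I 3 (m + 1) p, (r k * r' k) •
          perT ((m + 1) * p) (arr ((m + 1) * p) (gh₂ k.2.2 (windowMap 4 ((m + 1) * p) (torusBlockEquiv (m + 1) p (k.1, k.2.1)))))
      from Finset.sum_congr rfl fun k _ => by rw [e₁_eq_siteOf, Ljet₂_eq_perT]]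
  exact sum_smul_perT_arr_per p hw hw' (fun κ u => biLoc_gh₂ κ u δ) (fun κ u t => gh₂_imageShift _ κ u t) hδ
    (PeriodicArrayWrapLimit.const_nonneg_of_weight (hw 0)) hr hr'

/-- [folklore] **THE PACKED `L̂²`-PAIR WORD MULTIPLIED OUT** (finite torus-matrix algebra; `Ljet₁₁` is bond-DIAGONAL, `e₁` injective):
`Σ_k Σ_l (r k·r′ l) • (L̂²)_{e₁ k, e₁ l} = D·L̂ + Jᵣ·Jᵣ′ + Jᵣ′·Jᵣ + L̂·D`, `D := Σ_k (r k·r′ k) • Ljet₂ (e₁ k)`, `Jᵣ := Σ_k r k • Ljet (e₁ k)`. -/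
theorem sum_sum_smul_Lsq₁₁ (r r' : I 3 (m + 1) p → ℝ) :
    ∑ k : I 3 (m + 1) p, ∑ l : I 3 (m + 1) p, (r k * r' l) • Lsq₁₁ ((m + 1) * p) (e₁ (m + 1) p k) (e₁ (m + 1) p l)
      = (∑ k : I 3 (m + 1) p, (r k * r' k) • Ljet₂ ((m + 1) * p) (e₁ (m + 1) p k)) * Lhat ((m + 1) * p)
        + (∑ k : I 3 (m + 1) p, r k • Ljet ((m + 1) * p) (e₁ (m + 1) p k)) * (∑ l : I 3 (m + 1) p, r' l • Ljet ((m + 1) * p) (e₁ (m + 1) p l))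
        + (∑ l : I 3 (m + 1) p, r' l • Ljet ((m + 1) * p) (e₁ (m + 1) p l)) * (∑ k : I 3 (m + 1) p, r k • Ljet ((m + 1) * p) (e₁ (m + 1) p k))
        + Lhat ((m + 1) * p) * (∑ k : I 3 (m + 1) p, (r k * r' k) • Ljet₂ ((m + 1) * p) (e₁ (m + 1) p k)) := by
  have hL : ∀ k l : I 3 (m + 1) p, Ljet₁₁ ((m + 1) * p) (e₁ (m + 1) p k) (e₁ (m + 1) p l)
      = if k = l then Ljet₂ ((m + 1) * p) (e₁ (m + 1) p k) else 0 := by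
    intro k l
    by_cases h : k = l
    · subst h; rw [if_pos rfl, Ljet₁₁_self]
    · rw [if_neg h, Ljet₁₁_of_ne]
      exact fun h' => h ((e₁ (m + 1) p).injective h')
  have h1 : ∑ k : I 3 (m + 1) p, ∑ l : I 3 (m + 1) p, (r k * r' l) • (Ljet₁₁ ((m + 1) * p) (e₁ (m + 1) p k) (e₁ (m + 1) p l) * Lhat ((m + 1) * p))
      = (∑ k : I 3 (m + 1) p, (r k * r' k) • Ljet₂ ((m + 1) * p) (e₁ (m + 1) p k)) * Lhat ((m + 1) * p) := by
    simp only [hL, ite_mul, zero_mul, smul_ite, smul_zero, Finset.sum_ite_eq, Finset.mem_univ, if_true, Finset.sum_mul, Matrix.smul_mul]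
  have h4 : ∑ k : I 3 (m + 1) p, ∑ l : I 3 (m + 1) p, (r k * r' l) • (Lhat ((m + 1) * p) * Ljet₁₁ ((m + 1) * p) (e₁ (m + 1) p k) (e₁ (m + 1) p l))
      = Lhat ((m + 1) * p) * (∑ k : I 3 (m + 1) p, (r k * r' k) • Ljet₂ ((m + 1) * p) (e₁ (m + 1) p k)) := by
    simp only [hL, mul_ite, mul_zero, smul_ite, smul_zero, Finset.sum_ite_eq, Finset.mem_univ, if_true, Matrix.mul_sum, Matrix.mul_smul]
  have h2 : ∑ k : I 3 (m + 1) p, ∑ l : I 3 (m + 1) p, (r k * r' l) • (Ljet ((m + 1) * p) (e₁ (m + 1) p k) * Ljet ((m + 1) * p) (e₁ (m + 1) p l))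
      = (∑ k : I 3 (m + 1) p, r k • Ljet ((m + 1) * p) (e₁ (m + 1) p k)) * (∑ l : I 3 (m + 1) p, r' l • Ljet ((m + 1) * p) (e₁ (m + 1) p l)) := by
    rw [Finset.sum_mul_sum]
    refine Finset.sum_congr rfl fun k _ => Finset.sum_congr rfl fun l _ => ?_
    rw [Matrix.smul_mul, Matrix.mul_smul, smul_smul]
  have h3 : ∑ k : I 3 (m + 1) p, ∑ l : I 3 (m + 1) p, (r k * r' l) • (Ljet ((m + 1) * p) (e₁ (m + 1) p l) * Ljet ((m + 1) * p) (e₁ (m + 1) p k))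
      = (∑ l : I 3 (m + 1) p, r' l • Ljet ((m + 1) * p) (e₁ (m + 1) p l)) * (∑ k : I 3 (m + 1) p, r k • Ljet ((m + 1) * p) (e₁ (m + 1) p k)) := by
    rw [Finset.sum_mul_sum, Finset.sum_comm]
    refine Finset.sum_congr rfl fun k _ => Finset.sum_congr rfl fun l _ => ?_
    rw [Matrix.smul_mul, Matrix.mul_smul, smul_smul, mul_comm (r l) (r' k)]
  simp only [Lsq₁₁, smul_add, Finset.sum_add_distrib, h1, h2, h3, h4]

/-- [folklore] Four periodised arrays of bi-localised kernels add up to the periodised array of the sum. -/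
theorem perT_arr_add₄ (s : ℕ) [NeZero s] {A B E D : MKer 4 Unit} {pA qA pB qB pE qE pD qD : Fin 4 → ℤ} {CA CB CE CD δA δB δE δD : ℝ}
    (hA : BiLoc A pA qA CA δA) (hδA : 0 < δA) (hB : BiLoc B pB qB CB δB) (hδB : 0 < δB) (hE : BiLoc E pE qE CE δE) (hδE : 0 < δE)
    (hD : BiLoc D pD qD CD δD) (hδD : 0 < δD) :
    perT s (arr s A) + perT s (arr s B) + perT s (arr s E) + perT s (arr s D) = perT s (arr s (A + B + E + D)) := by
  have rA := summable_row_arr s hA hδA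
  have rB := summable_row_arr s hB hδB
  have rE := summable_row_arr s hE hδE
  have rD := summable_row_arr s hD hδD
  have eAB : arr s (A + B) = arr s A + arr s B := arr_add s hA hδA hB hδB
  have rAB : ∀ x, Summable fun y => arr s (A + B) x y () () := fun x => by
    rw [eAB]; exact (rA x).add (rB x)
  have eABE : arr s (A + B + E) = arr s (A + B) + arr s E := by
    funext x y a b
    exact ((PeriodicArrays.summable_arr_term hA hδA s x y a b).add (PeriodicArrays.summable_arr_term hB hδB s x y a b)).tsum_add
      (PeriodicArrays.summable_arr_term hE hδE s x y a b)
  have rABE : ∀ x, Summable fun y => arr s (A + B + E) x y () () := fun x => by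
    rw [eABE]; exact (rAB x).add (rE x)
  have eABED : arr s (A + B + E + D) = arr s (A + B + E) + arr s D := by
    funext x y a b
    exact (((PeriodicArrays.summable_arr_term hA hδA s x y a b).add (PeriodicArrays.summable_arr_term hB hδB s x y a b)).add
      (PeriodicArrays.summable_arr_term hE hδE s x y a b)).tsum_add (PeriodicArrays.summable_arr_term hD hδD s x y a b)
  rw [eABED, perT_add s rABE rD, eABE, perT_add s rAB rE, eAB, perT_add s rA rB]

/-- [folklore] **THE PACKED `L̂²`-PAIR WORD IS ONE PERIODISED ARRAY — THE p-DEPENDENT PAIR FAMILY IN PRODUCT FORM (F-g16-1 «WRAP»).**  For weight families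
`wₛ` (centre `Pₛ`), `wₜ` (centre `Pₜ`) decaying at a rate `0 < δ ≤ ½` and their torus responses `rₛ`, `rₜ`:
`Σ_k Σ_l (rₛ k·rₜ l) • (L̂²)_{e₁ k, e₁ l} = perT s (arr s ℒ₂ˢ)`,
`ℒ₂ˢ := comp 𝒟ˢ lapU + comp 𝒢[wₛ] (arr s 𝒢[wₜ]) + comp 𝒢[wₜ] (arr s 𝒢[wₛ]) + comp lapU 𝒟ˢ`, `𝒢[w] := Σ_κ wsum (w κ) (ghCur κ)`,
`𝒟ˢ := Σ_κ wsum (wₛ κ) (u ↦ (Σ'_m wₜ κ (u + s·m)) · gh₂ κ u)` — ON EVERY TORUS, with no side condition: the products of the packed `Ljet`s are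
`perT(arr 𝒢ₛ)·perT(arr 𝒢ₜ) = perT(arr (𝒢ₛ ∘ arr s 𝒢ₜ))` (`TorusGhostPairStencils.perT_arr_mul_perT_arr`), the wrap-around being TA2's `arr` inside. -/
theorem sum_sum_smul_Lsq₁₁_eq_perT (wS wT : Fin 4 → (Fin 4 → ℤ) → ℝ) {CS CT : ℝ} {PS PT : Fin 4 → ℤ}
    (hwS : ∀ κ u, |wS κ u| ≤ CS * Real.exp (-δ * l1 (u - PS))) (hwT : ∀ κ u, |wT κ u| ≤ CT * Real.exp (-δ * l1 (u - PT))) (hδ : 0 < δ)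
    (hδ1 : δ ≤ 1 / 2) (rS rT : I 3 (m + 1) p → ℝ)
    (hrS : ∀ k, rS k = ∑' t : Fin 4 → ℤ, wS k.2.2 (imageShift ((m + 1) * p) (windowMap 4 ((m + 1) * p) (torusBlockEquiv (m + 1) p (k.1, k.2.1))) t))
    (hrT : ∀ k, rT k = ∑' t : Fin 4 → ℤ, wT k.2.2 (imageShift ((m + 1) * p) (windowMap 4 ((m + 1) * p) (torusBlockEquiv (m + 1) p (k.1, k.2.1))) t)) :
    ∑ k : I 3 (m + 1) p, ∑ l : I 3 (m + 1) p, (rS k * rT l) • Lsq₁₁ ((m + 1) * p) (e₁ (m + 1) p k) (e₁ (m + 1) p l)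
      = perT ((m + 1) * p) (arr ((m + 1) * p)
          (comp (fun x y a b => ∑ κ : Fin 4, wsum (wS κ) (fun u => fun x y a b =>
              (∑' t : Fin 4 → ℤ, wT κ (imageShift ((m + 1) * p) u t)) * gh₂ κ u x y a b) x y a b) lapU
            + comp (fun x y a b => ∑ κ : Fin 4, wsum (wS κ) (ghCur κ) x y a b)
                (arr ((m + 1) * p) (fun x y a b => ∑ κ : Fin 4, wsum (wT κ) (ghCur κ) x y a b))
            + comp (fun x y a b => ∑ κ : Fin 4, wsum (wT κ) (ghCur κ) x y a b)
                (arr ((m + 1) * p) (fun x y a b => ∑ κ : Fin 4, wsum (wS κ) (ghCur κ) x y a b))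
            + comp lapU (fun x y a b => ∑ κ : Fin 4, wsum (wS κ) (fun u => fun x y a b =>
              (∑' t : Fin 4 → ℤ, wT κ (imageShift ((m + 1) * p) u t)) * gh₂ κ u x y a b) x y a b))) := by
  have hCS : 0 ≤ CS := PeriodicArrayWrapLimit.const_nonneg_of_weight (hwS 0)
  have hCT : 0 ≤ CT := PeriodicArrayWrapLimit.const_nonneg_of_weight (hwT 0)
  have hδ2 : 0 < δ / 2 := half_pos hδ
  have hδ4 : 0 < δ / 2 / 2 := half_pos hδ2
  -- localisation of the packed `ℤ⁴` words (FILE 1), of the Laplacian leg and of the arrays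
  have hGS := biLoc_dirsum_wsum (d := 3) hwS (fun κ u => biLoc_ghCur κ u δ) hδ hCS
  have hGT := biLoc_dirsum_wsum (d := 3) hwT (fun κ u => biLoc_ghCur κ u δ) hδ hCT
  have hD := biLoc_dirsum_wsum_per (d := 3) hwS hwT (fun κ u => biLoc_gh₂ κ u δ) hδ hCS ((m + 1) * p)
  have hL : Decays lapU (|16 * Real.exp 1|) (δ / 2) := TameKernelCalculus.decays_of_le decays_lapU (by linarith)
  have hAS := decays_arr hGS hδ2 ((m + 1) * p)
  have hAT := decays_arr hGT hδ2 ((m + 1) * p)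
  -- the four pieces are bi-localised (any constants, any positive rates suffice for the additivity below)
  have hP1 := biLoc_comp_right hD hL hδ4.le (half_lt_self hδ2)
  have hP4 := ExpKernelCalculus.biLoc_comp_decays hL hD hδ4.le (half_lt_self hδ2)
  have hP2 := biLoc_comp_right (StepJetData.biLoc_weaken hGS le_rfl (half_le_self hδ2.le)) hAT (half_pos hδ4).le (half_lt_self hδ4)
  have hP3 := biLoc_comp_right (StepJetData.biLoc_weaken hGT le_rfl (half_le_self hδ2.le)) hAS (half_pos hδ4).le (half_lt_self hδ4)
  rw [sum_sum_smul_Lsq₁₁, sum_smul_Ljet p hwS hδ hrS, sum_smul_Ljet p hwT hδ hrT, sum_smul_Ljet₂ p hwS hwT hδ hrS hrT, Lhat_eq_perT,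
    perT_arr_mul_perT _ decays_lapU one_pos (fun x y t a b => lapU_imageShift _ x y t a b) hD hδ2,
    perT_arr_mul_perT_arr _ hGS hδ2 hGT hδ2, perT_arr_mul_perT_arr _ hGT hδ2 hGS hδ2,
    perT_mul_perT_arr _ decays_lapU one_pos (fun x y t a b => lapU_imageShift _ x y t a b) hD hδ2,
    perT_arr_add₄ _ hP1 hδ4 hP2 (half_pos hδ4) hP3 (half_pos hδ4) hP4 hδ4]

/-- [folklore] … read on `Site × Unit`: `Σ_k Σ_l (rₛ k·rₜ l) • ((L̂²)_{e₁ k, e₁ l})ᶠ = (arr s ℒ₂ˢ)^` (`KCombineCovTowers.submatrix_fst_perT`). -/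
theorem sum_sum_smul_Lsq₁₁_fst_eq_arr (wS wT : Fin 4 → (Fin 4 → ℤ) → ℝ) {CS CT : ℝ} {PS PT : Fin 4 → ℤ}
    (hwS : ∀ κ u, |wS κ u| ≤ CS * Real.exp (-δ * l1 (u - PS))) (hwT : ∀ κ u, |wT κ u| ≤ CT * Real.exp (-δ * l1 (u - PT))) (hδ : 0 < δ)
    (hδ1 : δ ≤ 1 / 2) (rS rT : I 3 (m + 1) p → ℝ)
    (hrS : ∀ k, rS k = ∑' t : Fin 4 → ℤ, wS k.2.2 (imageShift ((m + 1) * p) (windowMap 4 ((m + 1) * p) (torusBlockEquiv (m + 1) p (k.1, k.2.1))) t))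
    (hrT : ∀ k, rT k = ∑' t : Fin 4 → ℤ, wT k.2.2 (imageShift ((m + 1) * p) (windowMap 4 ((m + 1) * p) (torusBlockEquiv (m + 1) p (k.1, k.2.1))) t)) :
    ∑ k : I 3 (m + 1) p, ∑ l : I 3 (m + 1) p, (rS k * rT l) • (Lsq₁₁ ((m + 1) * p) (e₁ (m + 1) p k) (e₁ (m + 1) p l)).submatrix Prod.fst Prod.fst
      = Matrix.of (periodiseF ((m + 1) * p) (toF (arr ((m + 1) * p)
          (comp (fun x y a b => ∑ κ : Fin 4, wsum (wS κ) (fun u => fun x y a b =>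
              (∑' t : Fin 4 → ℤ, wT κ (imageShift ((m + 1) * p) u t)) * gh₂ κ u x y a b) x y a b) lapU
            + comp (fun x y a b => ∑ κ : Fin 4, wsum (wS κ) (ghCur κ) x y a b)
                (arr ((m + 1) * p) (fun x y a b => ∑ κ : Fin 4, wsum (wT κ) (ghCur κ) x y a b))
            + comp (fun x y a b => ∑ κ : Fin 4, wsum (wT κ) (ghCur κ) x y a b)
                (arr ((m + 1) * p) (fun x y a b => ∑ κ : Fin 4, wsum (wS κ) (ghCur κ) x y a b))
            + comp lapU (fun x y a b => ∑ κ : Fin 4, wsum (wS κ) (fun u => fun x y a b =>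
              (∑' t : Fin 4 → ℤ, wT κ (imageShift ((m + 1) * p) u t)) * gh₂ κ u x y a b) x y a b))))) := by
  rw [← submatrix_sum_sum_smul, sum_sum_smul_Lsq₁₁_eq_perT p wS wT hwS hwT hδ hδ1 rS rT hrS hrT, submatrix_fst_perT]

end LsqWords

/-! ## §4 «GRAM-COV-PACKED»: the covariant-Gram slot at response-packed jets -/

section GramCov

variable (m : ℕ) {a : ℝ} (p : ℕ) [NeZero p] {r : Fin 4 → ℕ}

/-- [folklore] **«GRAM-COV-PACKED» — THE TWISTED COVARIANT-GRAM TOWER SLOT OF `identity_array_currency_cov_What0_stripped` AT RESPONSE-PACKED JETS IS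
THE `Cgh` TORUS FUNCTIONAL OF PERIODISED ARRAYS OF THE PACKED GHOST WORDS.**  On the torus `Site 4 ((m+1)·p)` (root `r ∈ box 4 (m+1)`, `0 < a`), for
weight families `wₛ` (centre `Pₛ`), `wₜ` (centre `Pₜ`) decaying at a rate `0 < δ ≤ ½`, torus responses `rₛ rₜ` (letters `hrₛ hrₜ`), THE CONVENTION's gauge
jets packed by them (`hW•`: `Wₛ = Σ_k rₛ k • (Ê_{e₁ k}·N̂)`, `Wₛₜ = Σ_k Σ_l (rₛ k·rₜ l) • [k = l]•(Ê_{e₁ k}·N̂)`), TB4-W's co-frame jets packed by them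
(«COFRAME-PACK» as the pinning letters `hT• hA•`: `T₀ = Tjet₀`, `Tₛ = Σ_k rₛ k • Tjet₁ (e₁ k)`, `Tₛₜ = Σ_k Σ_l (rₛ k·rₜ l) • Tjet₁₁ (e₁ k) (e₁ l)`, `A•` likewise),
and OPAQUE form jets `kₛ kₜ kₛₜ` under the ONE-SIDED WARD-L letters `hEₛ hEₜ hEₛₜ` against the packed gauge jets:
`hessT ((gram₀ Ŵ₀ (K̂ + gram₀ T₀ A₀))⁻¹; tgram₁ Ŵ₀ Wₛ (K̂ + gram₀ T₀ A₀) (kₛ + tgram₁ T₀ Tₛ A₀ Aₛ), …ₜ, tgramMix Ŵ₀ Wₛ Wₜ Wₛₜ (K̂ + gram₀ T₀ A₀) (…ₛ) (…ₜ) (kₛₜ + tgramMix T A))`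
`= hessT ((Cgh (m+1) a)^; (arr s ℒ₁[wₛ])^, (arr s ℒ₁[wₜ])^, (arr s ℒ₂ˢ[wₛ,wₜ])^)`,
`ℒ₁[w] := Σ_κ wsum (w κ) (Lgh κ)`, `ℒ₂ˢ` = §3's packed pair family in PRODUCT form (route: `K`-drop under WARD-L → owner's «SLOT-PACK» `tgram₁_packed` ∕
`tgramMix_packed` ∕ `hessT_tgram_packed` → per bond pair `hessT_tgram_eq_gram` ∘ `hessT_gramCov_B_eq_Gjet` ∘ `hessT_Gjet_eq_Cgh_Lsq` (ARBITRARY torus bond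
pairs) → `hessT_packed` BACKWARDS → §3). -/
theorem hessT_tgramCov_packed_eq_arr (ha : 0 < a) (hr : r ∈ box 4 (m + 1))
    (wS wT : Fin 4 → (Fin 4 → ℤ) → ℝ) {CS CT δ : ℝ} {PS PT : Fin 4 → ℤ}
    (hwS : ∀ κ u, |wS κ u| ≤ CS * Real.exp (-δ * l1 (u - PS))) (hwT : ∀ κ u, |wT κ u| ≤ CT * Real.exp (-δ * l1 (u - PT))) (hδ : 0 < δ)
    (hδ1 : δ ≤ 1 / 2) (rS rT : I 3 (m + 1) p → ℝ)
    (hrS : ∀ k, rS k = ∑' t : Fin 4 → ℤ, wS k.2.2 (imageShift ((m + 1) * p) (windowMap 4 ((m + 1) * p) (torusBlockEquiv (m + 1) p (k.1, k.2.1))) t))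
    (hrT : ∀ k, rT k = ∑' t : Fin 4 → ℤ, wT k.2.2 (imageShift ((m + 1) * p) (windowMap 4 ((m + 1) * p) (torusBlockEquiv (m + 1) p (k.1, k.2.1))) t))
    (kₛ kₜ kₛₜ : Matrix (I 3 (m + 1) p) (I 3 (m + 1) p) ℝ)
    {Wₛ Wₜ Wₛₜ : Matrix (I 3 (m + 1) p) (CombRows (toSite r) (m + 1) p) ℝ}
    (hWₛ : Wₛ = ∑ k : I 3 (m + 1) p, rS k • ((Djet ((m + 1) * p) (e₁ (m + 1) p k)).submatrix (e₁ (m + 1) p) id * Nhat r (m + 1) p))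
    (hWₜ : Wₜ = ∑ k : I 3 (m + 1) p, rT k • ((Djet ((m + 1) * p) (e₁ (m + 1) p k)).submatrix (e₁ (m + 1) p) id * Nhat r (m + 1) p))
    (hWₛₜ : Wₛₜ = ∑ k : I 3 (m + 1) p, ∑ l : I 3 (m + 1) p, (rS k * rT l) •
      (if k = l then (Djet ((m + 1) * p) (e₁ (m + 1) p k)).submatrix (e₁ (m + 1) p) id * Nhat r (m + 1) p else 0))
    (hEₛ : kₛ * What0 r (m + 1) p + Khat (d := 3) (m + 1) p * Wₛ = 0) (hEₜ : kₜ * What0 r (m + 1) p + Khat (d := 3) (m + 1) p * Wₜ = 0)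
    (hEₛₜ : kₛₜ * What0 r (m + 1) p + kₛ * Wₜ + kₜ * Wₛ + Khat (d := 3) (m + 1) p * Wₛₜ = 0)
    {T₀ Tₛ Tₜ Tₛₜ : Matrix (CombRows (toSite r) (m + 1) p) (I 3 (m + 1) p) ℝ}
    {A₀ Aₛ Aₜ Aₛₜ : Matrix (CombRows (toSite r) (m + 1) p) (CombRows (toSite r) (m + 1) p) ℝ}
    (hT₀ : T₀ = Tjet₀ ((m + 1) * p) (Nhat r (m + 1) p) (e₁ (m + 1) p))
    (hTₛ : Tₛ = ∑ k : I 3 (m + 1) p, rS k • Tjet₁ ((m + 1) * p) (e₁ (m + 1) p k) (Nhat r (m + 1) p) (e₁ (m + 1) p))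
    (hTₜ : Tₜ = ∑ k : I 3 (m + 1) p, rT k • Tjet₁ ((m + 1) * p) (e₁ (m + 1) p k) (Nhat r (m + 1) p) (e₁ (m + 1) p))
    (hTₛₜ : Tₛₜ = ∑ k : I 3 (m + 1) p, ∑ l : I 3 (m + 1) p, (rS k * rT l) •
      Tjet₁₁ ((m + 1) * p) (e₁ (m + 1) p k) (e₁ (m + 1) p l) (Nhat r (m + 1) p) (e₁ (m + 1) p))
    (hA₀ : A₀ = Ajet₀ ((m + 1) * p) (Nhat r (m + 1) p))
    (hAₛ : Aₛ = ∑ k : I 3 (m + 1) p, rS k • Ajet₁ ((m + 1) * p) (e₁ (m + 1) p k) (Nhat r (m + 1) p))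
    (hAₜ : Aₜ = ∑ k : I 3 (m + 1) p, rT k • Ajet₁ ((m + 1) * p) (e₁ (m + 1) p k) (Nhat r (m + 1) p))
    (hAₛₜ : Aₛₜ = ∑ k : I 3 (m + 1) p, ∑ l : I 3 (m + 1) p, (rS k * rT l) •
      Ajet₁₁ ((m + 1) * p) (e₁ (m + 1) p k) (e₁ (m + 1) p l) (Nhat r (m + 1) p)) :
    hessT (gram₀ (What0 r (m + 1) p) (Khat (d := 3) (m + 1) p + gram₀ T₀ A₀))⁻¹
        (tgram₁ (What0 r (m + 1) p) Wₛ (Khat (d := 3) (m + 1) p + gram₀ T₀ A₀) (kₛ + tgram₁ T₀ Tₛ A₀ Aₛ))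
        (tgram₁ (What0 r (m + 1) p) Wₜ (Khat (d := 3) (m + 1) p + gram₀ T₀ A₀) (kₜ + tgram₁ T₀ Tₜ A₀ Aₜ))
        (tgramMix (What0 r (m + 1) p) Wₛ Wₜ Wₛₜ (Khat (d := 3) (m + 1) p + gram₀ T₀ A₀) (kₛ + tgram₁ T₀ Tₛ A₀ Aₛ) (kₜ + tgram₁ T₀ Tₜ A₀ Aₜ)
          (kₛₜ + tgramMix T₀ Tₛ Tₜ Tₛₜ A₀ Aₛ Aₜ Aₛₜ))
      = hessT (Matrix.of (periodiseF ((m + 1) * p) (toF (Cgh (m + 1) a))))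
          (Matrix.of (periodiseF ((m + 1) * p) (toF (arr ((m + 1) * p) (fun x y a b => ∑ κ : Fin 4, wsum (wS κ) (Lgh κ) x y a b)))))
          (Matrix.of (periodiseF ((m + 1) * p) (toF (arr ((m + 1) * p) (fun x y a b => ∑ κ : Fin 4, wsum (wT κ) (Lgh κ) x y a b)))))
          (Matrix.of (periodiseF ((m + 1) * p) (toF (arr ((m + 1) * p)
            (comp (fun x y a b => ∑ κ : Fin 4, wsum (wS κ) (fun u => fun x y a b =>
                (∑' t : Fin 4 → ℤ, wT κ (imageShift ((m + 1) * p) u t)) * gh₂ κ u x y a b) x y a b) lapU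
              + comp (fun x y a b => ∑ κ : Fin 4, wsum (wS κ) (ghCur κ) x y a b)
                  (arr ((m + 1) * p) (fun x y a b => ∑ κ : Fin 4, wsum (wT κ) (ghCur κ) x y a b))
              + comp (fun x y a b => ∑ κ : Fin 4, wsum (wT κ) (ghCur κ) x y a b)
                  (arr ((m + 1) * p) (fun x y a b => ∑ κ : Fin 4, wsum (wS κ) (ghCur κ) x y a b))
              + comp lapU (fun x y a b => ∑ κ : Fin 4, wsum (wS κ) (fun u => fun x y a b =>
                (∑' t : Fin 4 → ℤ, wT κ (imageShift ((m + 1) * p) u t)) * gh₂ κ u x y a b) x y a b)))))) := by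
  have hE₀ : Khat (d := 3) (m + 1) p * What0 r (m + 1) p = 0 := Khat_mul_What0 r (m + 1) p hr
  -- (1) the `K`-parts drop under the ONE-SIDED WARD-L letters
  rw [gram₀_add_of_wardL hE₀, tgram₁_add_eq_of_wardL hE₀ hEₛ, tgram₁_add_eq_of_wardL hE₀ hEₜ, tgramMix_add_eq_of_wardL hE₀ hEₛ hEₜ hEₛₜ]
  subst hT₀ hA₀ hTₛ hTₜ hTₛₜ hAₛ hAₜ hAₛₜ hWₛ hWₜ hWₛₜ
  have hT := det_Tjet₀_mul_What0_ne_zero m p ha hr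
  have hA := det_Ajet₀_Nhat_ne_zero m p ha hr
  -- (2) the twisted co-frame jets at packed data are packed (owner's «SLOT-PACK»), then the slot splits into bond pairs
  rw [tgram₁_packed (Tjet₀ ((m + 1) * p) (Nhat r (m + 1) p) (e₁ (m + 1) p)) (Ajet₀ ((m + 1) * p) (Nhat r (m + 1) p)) rS,
    tgram₁_packed (Tjet₀ ((m + 1) * p) (Nhat r (m + 1) p) (e₁ (m + 1) p)) (Ajet₀ ((m + 1) * p) (Nhat r (m + 1) p)) rT,
    tgramMix_packed (Tjet₀ ((m + 1) * p) (Nhat r (m + 1) p) (e₁ (m + 1) p)) (Ajet₀ ((m + 1) * p) (Nhat r (m + 1) p)) rS rT,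
    hessT_tgram_packed]
  -- (3) per bond pair: the single-pair chain, for ARBITRARY torus bond pairs
  have hX₂ : ∀ k l : I 3 (m + 1) p,
      (if k = l then (Djet ((m + 1) * p) (e₁ (m + 1) p k)).submatrix (e₁ (m + 1) p) id * Nhat r (m + 1) p else 0)
        = (if e₁ (m + 1) p k = e₁ (m + 1) p l then (Djet ((m + 1) * p) (e₁ (m + 1) p k)).submatrix (e₁ (m + 1) p) id * Nhat r (m + 1) p
            else 0) := by
    intro k l; simp only [EmbeddingLike.apply_eq_iff_eq]
  have hpair : ∀ k l : I 3 (m + 1) p,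
      hessT (gram₀ (What0 r (m + 1) p)
          (gram₀ (Tjet₀ ((m + 1) * p) (Nhat r (m + 1) p) (e₁ (m + 1) p)) (Ajet₀ ((m + 1) * p) (Nhat r (m + 1) p))))⁻¹
          (tgram₁ (What0 r (m + 1) p) ((Djet ((m + 1) * p) (e₁ (m + 1) p k)).submatrix (e₁ (m + 1) p) id * Nhat r (m + 1) p)
            (gram₀ (Tjet₀ ((m + 1) * p) (Nhat r (m + 1) p) (e₁ (m + 1) p)) (Ajet₀ ((m + 1) * p) (Nhat r (m + 1) p)))
            (tgram₁ (Tjet₀ ((m + 1) * p) (Nhat r (m + 1) p) (e₁ (m + 1) p)) (Tjet₁ ((m + 1) * p) (e₁ (m + 1) p k) (Nhat r (m + 1) p) (e₁ (m + 1) p))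
              (Ajet₀ ((m + 1) * p) (Nhat r (m + 1) p)) (Ajet₁ ((m + 1) * p) (e₁ (m + 1) p k) (Nhat r (m + 1) p))))
          (tgram₁ (What0 r (m + 1) p) ((Djet ((m + 1) * p) (e₁ (m + 1) p l)).submatrix (e₁ (m + 1) p) id * Nhat r (m + 1) p)
            (gram₀ (Tjet₀ ((m + 1) * p) (Nhat r (m + 1) p) (e₁ (m + 1) p)) (Ajet₀ ((m + 1) * p) (Nhat r (m + 1) p)))
            (tgram₁ (Tjet₀ ((m + 1) * p) (Nhat r (m + 1) p) (e₁ (m + 1) p)) (Tjet₁ ((m + 1) * p) (e₁ (m + 1) p l) (Nhat r (m + 1) p) (e₁ (m + 1) p))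
              (Ajet₀ ((m + 1) * p) (Nhat r (m + 1) p)) (Ajet₁ ((m + 1) * p) (e₁ (m + 1) p l) (Nhat r (m + 1) p))))
          (tgramMix (What0 r (m + 1) p) ((Djet ((m + 1) * p) (e₁ (m + 1) p k)).submatrix (e₁ (m + 1) p) id * Nhat r (m + 1) p)
            ((Djet ((m + 1) * p) (e₁ (m + 1) p l)).submatrix (e₁ (m + 1) p) id * Nhat r (m + 1) p)
            (if k = l then (Djet ((m + 1) * p) (e₁ (m + 1) p k)).submatrix (e₁ (m + 1) p) id * Nhat r (m + 1) p else 0)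
            (gram₀ (Tjet₀ ((m + 1) * p) (Nhat r (m + 1) p) (e₁ (m + 1) p)) (Ajet₀ ((m + 1) * p) (Nhat r (m + 1) p)))
            (tgram₁ (Tjet₀ ((m + 1) * p) (Nhat r (m + 1) p) (e₁ (m + 1) p)) (Tjet₁ ((m + 1) * p) (e₁ (m + 1) p k) (Nhat r (m + 1) p) (e₁ (m + 1) p))
              (Ajet₀ ((m + 1) * p) (Nhat r (m + 1) p)) (Ajet₁ ((m + 1) * p) (e₁ (m + 1) p k) (Nhat r (m + 1) p)))
            (tgram₁ (Tjet₀ ((m + 1) * p) (Nhat r (m + 1) p) (e₁ (m + 1) p)) (Tjet₁ ((m + 1) * p) (e₁ (m + 1) p l) (Nhat r (m + 1) p) (e₁ (m + 1) p))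
              (Ajet₀ ((m + 1) * p) (Nhat r (m + 1) p)) (Ajet₁ ((m + 1) * p) (e₁ (m + 1) p l) (Nhat r (m + 1) p)))
            (tgramMix (Tjet₀ ((m + 1) * p) (Nhat r (m + 1) p) (e₁ (m + 1) p)) (Tjet₁ ((m + 1) * p) (e₁ (m + 1) p k) (Nhat r (m + 1) p) (e₁ (m + 1) p))
              (Tjet₁ ((m + 1) * p) (e₁ (m + 1) p l) (Nhat r (m + 1) p) (e₁ (m + 1) p))
              (Tjet₁₁ ((m + 1) * p) (e₁ (m + 1) p k) (e₁ (m + 1) p l) (Nhat r (m + 1) p) (e₁ (m + 1) p))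
              (Ajet₀ ((m + 1) * p) (Nhat r (m + 1) p)) (Ajet₁ ((m + 1) * p) (e₁ (m + 1) p k) (Nhat r (m + 1) p))
              (Ajet₁ ((m + 1) * p) (e₁ (m + 1) p l) (Nhat r (m + 1) p)) (Ajet₁₁ ((m + 1) * p) (e₁ (m + 1) p k) (e₁ (m + 1) p l) (Nhat r (m + 1) p))))
        = hessT (Matrix.of (periodiseF ((m + 1) * p) (toF (Cgh (m + 1) a))))
            ((Lsq₁ ((m + 1) * p) (e₁ (m + 1) p k)).submatrix Prod.fst Prod.fst) ((Lsq₁ ((m + 1) * p) (e₁ (m + 1) p l)).submatrix Prod.fst Prod.fst)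
            ((Lsq₁₁ ((m + 1) * p) (e₁ (m + 1) p k) (e₁ (m + 1) p l)).submatrix Prod.fst Prod.fst) := by
    intro k l
    rw [hessT_tgram_eq_gram _ _ _ _ _ _ _ _ _ _ _ _ hT hA, hessT_gramCov_B_eq_Gjet m p ha hr (e₁ (m + 1) p k) (e₁ (m + 1) p l) rfl rfl (hX₂ k l),
      hessT_Gjet_eq_Cgh_Lsq m p ha hr]
  simp only [hpair]
  -- (4) re-pack (owner's `hessT_packed` read backwards) and identify the packed words (§3)
  rw [← hessT_packed (Matrix.of (periodiseF ((m + 1) * p) (toF (Cgh (m + 1) a)))) rS rT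
      (fun k => (Lsq₁ ((m + 1) * p) (e₁ (m + 1) p k)).submatrix Prod.fst Prod.fst)
      (fun l => (Lsq₁ ((m + 1) * p) (e₁ (m + 1) p l)).submatrix Prod.fst Prod.fst)
      (fun k l => (Lsq₁₁ ((m + 1) * p) (e₁ (m + 1) p k) (e₁ (m + 1) p l)).submatrix Prod.fst Prod.fst),
    sum_smul_Lsq₁_fst p hwS hδ hδ1 hrS, sum_smul_Lsq₁_fst p hwT hδ hδ1 hrT,
    sum_sum_smul_Lsq₁₁_fst_eq_arr p wS wT hwS hwT hδ hδ1 rS rT hrS hrT]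

end GramCov

end Summit.QuantumFields.BalabanUV.Beta.D1BFx.PackedTowerSlotsGram

end
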